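import Mathlib.Analysis.Convex.Contractible
import Literature.Analysis.Complex.KoebeSquareRootMapCovering
import HarnessLib

/-!
# Koebe's square-root step: based holomorphic lifting through `q` and the exhaustion bound

Topic `Literature/Analysis/Complex`; continuation of `KoebeSquareRootMap.lean` /
`KoebeSquareRootMapCovering.lean` (programme «UNIF-G1P» of the abc-iut cell, GAP row `G-L4t8g7-1`,
toward the named fact `Complex.PlaneDomainDiscCovering`).

Fisher–Hubbard–Wittner (PAMS 104 (1988), Part b, p. 415) iterate the square-root map
`q_n = m_{a_n} ∘ sq ∘ m_{b_n}` of the unit disc `𝔻` along a point `a_n ∉ U_{n-1}` and lift through it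
(«there exist unique analytic mappings `f_n : Ũ → U_n` with `f_n(Õ) = 0` which make the diagram
commute», Part c, p. 415); their concluding remark (2) (p. 417) normalises «their derivatives to be
positive».  This file packages exactly that step for the Ũ-free form of the argument (maps from the
disc instead of from the abstract universal cover):

* `Koebe.hasSqrt_ball` — the unit disc has the square-root property;
* **`Koebe.exists_unwinding`** — for an open `V ⊆ 𝔻` with `0 ∈ V` and `w ∈ 𝔻 ∖ V`: the rotated
  square-root map `B = q ∘ (u ·)` (`q = φ_{-w} ∘ sq ∘ φ_{-c}`, `c² = -w`, `u = c̄/‖c‖`) is a holomorphic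
  self-map of `𝔻` with `B 0 = 0` and `B′(0) = 2‖c‖/(1 + ‖c‖²)` REAL POSITIVE, satisfying the
  **exhaustion bound** `(1 - ‖w‖)²/8 ≤ 1 - B′(0)`; on `V' := 𝔻 ∩ B⁻¹(V) ∋ 0` (open) `B′ ≠ 0` (the
  critical value `w` of `B` is not in `V`); and the **based holomorphic lifting property**: every
  holomorphic `g : 𝔻 → V` lifts through `B` to a holomorphic `ĝ : 𝔻 → V'` with any prescribed value
  `ĝ 0 = y ∈ V'` over `g 0 = B y` — a holomorphic square root of the zero-free function `φ_w ∘ g`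
  with its sign fixed by `y` (no covering-space theory is needed for maps from the disc).

The map `q`, `q(𝔻) ⊆ 𝔻`, `q 0 = 0` and `q′(0)` are consumed BY NAME from `KoebeSquareRootMap.lean`
(`Koebe.mapsTo_sqMap`, `Koebe.differentiableOn_sqMap`, `Koebe.deriv_sqMap_zero`); the inverse
relations of `φ_{±p}` from `KoebeSquareRootMapCovering.lean`.  Proof-only; no definition.

## References
* Y. Fisher, J. H. Hubbard, B. S. Wittner, PAMS 104 (1988) 413–418, Part b/c p. 415, Remark (2)
  p. 417. [FisherHubbardWittner1988]
* J. B. Conway, *Functions of One Complex Variable I* (1978), Ch. IV Cor. 6.17, Ch. VI Prop. 2.2,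
  Ch. VII Lemma 4.3. [Conway1978]
-/

noncomputable section

namespace Literature.Analysis.Complex

namespace Koebe

open _root_.Complex _root_.Metric _root_.Set _root_.Function _root_.Filter _root_.Topology
open scoped ComplexConjugate

/-- The open unit disc has the square-root property (it is convex, hence simply connected;
Conway IV.6.17). [cite: Conway1978, Ch. IV Cor. 6.17] -/
theorem hasSqrt_ball : HasSqrt (ball (0 : ℂ) 1) := by
  have : ContractibleSpace (ball (0 : ℂ) 1) :=
    (convex_ball (0 : ℂ) 1).contractibleSpace ⟨0, mem_ball_self one_pos⟩
  have hsc : IsSimplyConnected (ball (0 : ℂ) 1) := by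
    change SimplyConnectedSpace (ball (0 : ℂ) 1)
    infer_instance
  exact hsc.hasSqrt isOpen_ball

/-- The chain rule for `q = φ_{-w} ∘ sq ∘ φ_{-c}` at every point of the closed disc.
[cite: FisherHubbardWittner1988, p.415 (q_n)] -/
theorem hasDerivAt_sqMap {w c z : ℂ} (hw : ‖w‖ < 1) (hc : c ^ 2 = -w) (hz : ‖z‖ ≤ 1) :
    HasDerivAt (fun z => discMobius (-w) (discMobius (-c) z ^ 2))
      (deriv (discMobius (-w)) (discMobius (-c) z ^ 2) * (2 * discMobius (-c) z) *
        deriv (discMobius (-c)) z) z := by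
  have hnegc : ‖-c‖ < 1 := by rw [norm_neg]; exact norm_lt_one hw hc
  have hnegw : ‖-w‖ < 1 := by rwa [norm_neg]
  have hmz : ‖discMobius (-c) z‖ ≤ 1 := by
    rcases hz.lt_or_eq with h | h
    · exact (mem_ball_zero_iff.1 (mapsTo_discMobius hnegc (mem_ball_zero_iff.2 h))).le
    · -- on the unit circle `φ_{-c}` still has norm `≤ 1`
      have hD : 1 - conj (-c) * z ≠ 0 := one_sub_conj_mul_ne_zero hnegc hz
      rw [discMobius_apply, norm_div, div_le_one (norm_pos_iff.2 hD)]
      have key := norm_sq_one_sub_conj_mul_sub (-c) z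
      rw [h] at key
      have : ‖z - -c‖ ^ 2 = ‖1 - conj (-c) * z‖ ^ 2 := by linarith
      nlinarith [norm_nonneg (z - -c), norm_nonneg (1 - conj (-c) * z), sq_nonneg
        (‖z - -c‖ - ‖1 - conj (-c) * z‖), sq_nonneg (‖z - -c‖ + ‖1 - conj (-c) * z‖)]
  have h2 : ‖discMobius (-c) z ^ 2‖ ≤ 1 := by
    rw [norm_pow]; nlinarith [norm_nonneg (discMobius (-c) z)]
  have hsq : HasDerivAt (fun x : ℂ => x ^ 2) (2 * discMobius (-c) z) (discMobius (-c) z) := by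
    simpa using hasDerivAt_pow 2 (discMobius (-c) z)
  have hin : HasDerivAt (fun x => discMobius (-c) x ^ 2)
      (2 * discMobius (-c) z * deriv (discMobius (-c)) z) z :=
    hsq.comp z (differentiableAt_discMobius hnegc hz).hasDerivAt
  have := (differentiableAt_discMobius hnegw h2).hasDerivAt.comp z hin
  have h' : HasDerivAt (fun z => discMobius (-w) (discMobius (-c) z ^ 2))
      (deriv (discMobius (-w)) (discMobius (-c) z ^ 2) *
        (2 * discMobius (-c) z * deriv (discMobius (-c)) z)) z := this
  convert h' using 1
  ring

/-- **The square-root step with base points** (FHW Part b/c p. 415, Remark (2) p. 417; Conway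
VII.4.3, proof of (4.6), read in the covering direction).  Let `V ⊆ 𝔻` be open with `0 ∈ V` and
let `w ∈ 𝔻 ∖ V`.  There are a holomorphic self-map `B` of `𝔻` (the square-root map `q` followed a
rotation), an open set `V' = 𝔻 ∩ B⁻¹(V) ∋ 0` and a real number `β = B′(0)` with: `B 0 = 0`;
`0 < β < 1` and `(1 - ‖w‖)²/8 ≤ 1 - β`; `B′ ≠ 0` on `V'`; `B(V') ⊆ V`; and every holomorphic
`g : 𝔻 → V` lifts through `B` to a holomorphic `ĝ : 𝔻 → V'` with prescribed value `ĝ 0 = y` over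
`g 0 = B y`. [cite: FisherHubbardWittner1988, Part c p.415 (the lifts f_n) and Remark (2) p.417] -/
theorem exists_unwinding {V : Set ℂ} (hVo : IsOpen V) (hV : V ⊆ ball (0 : ℂ) 1) (h0 : (0 : ℂ) ∈ V)
    {w : ℂ} (hw : ‖w‖ < 1) (hwV : w ∉ V) :
    ∃ (B : ℂ → ℂ) (V' : Set ℂ) (β : ℝ),
      DifferentiableOn ℂ B (ball 0 1) ∧ MapsTo B (ball 0 1) (ball 0 1) ∧ B 0 = 0 ∧
      deriv B 0 = β ∧ 0 < β ∧ β < 1 ∧ (1 - ‖w‖) ^ 2 / 8 ≤ 1 - β ∧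
      IsOpen V' ∧ V' ⊆ ball 0 1 ∧ (0 : ℂ) ∈ V' ∧ (∀ z ∈ ball (0 : ℂ) 1, z ∈ V' ↔ B z ∈ V) ∧
      MapsTo B V' V ∧ (∀ z ∈ V', deriv B z ≠ 0) ∧
      (∀ g : ℂ → ℂ, DifferentiableOn ℂ g (ball 0 1) → MapsTo g (ball 0 1) V →
        ∀ y ∈ V', B y = g 0 →
          ∃ gl : ℂ → ℂ, DifferentiableOn ℂ gl (ball 0 1) ∧ MapsTo gl (ball 0 1) V' ∧ gl 0 = y ∧
            ∀ z ∈ ball (0 : ℂ) 1, B (gl z) = g z) := by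
  classical
  have hw0 : w ≠ 0 := fun h ↦ hwV (h ▸ h0)
  -- a square root `c` of `-w`
  set c : ℂ := (-w) ^ (1 / 2 : ℂ) with hc
  have hc2 : c ^ 2 = -w := by
    rw [hc, ← cpow_nat_mul]
    norm_num
  have hnc2 : ‖c‖ ^ 2 = ‖w‖ := norm_sq_eq hc2
  have hc0 : c ≠ 0 := by
    intro h
    rw [h, zero_pow two_ne_zero] at hc2
    exact hw0 (neg_eq_zero.1 hc2.symm)
  have hcn : 0 < ‖c‖ := norm_pos_iff.2 hc0
  have hc1 : ‖c‖ < 1 := norm_lt_one hw hc2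
  have hnegc : ‖-c‖ < 1 := by rwa [norm_neg]
  have hnegw : ‖-w‖ < 1 := by rwa [norm_neg]
  -- the rotation `u = conj c / ‖c‖`
  set u : ℂ := conj c / (‖c‖ : ℂ) with hu
  have hun : ‖u‖ = 1 := by
    rw [hu, norm_div, norm_conj, Complex.norm_real, Real.norm_of_nonneg hcn.le, div_self hcn.ne']
  have hu0 : u ≠ 0 := norm_ne_zero_iff.1 (by rw [hun]; exact one_ne_zero)
  have huc : u * c = (‖c‖ : ℂ) := by
    rw [hu, div_mul_eq_mul_div, conj_mul', div_eq_iff (by exact_mod_cast hcn.ne')]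
    ring
  have hconju : conj u * u = 1 := by
    rw [conj_mul', hun]
    norm_num
  -- `B = q ∘ (u ·)`
  set q : ℂ → ℂ := fun z ↦ discMobius (-w) (discMobius (-c) z ^ 2) with hq
  set B : ℂ → ℂ := fun z ↦ q (u * z) with hB
  have hρn : ∀ z, ‖u * z‖ = ‖z‖ := fun z ↦ by simp [hun]
  have hρball : MapsTo (fun z ↦ u * z) (ball (0 : ℂ) 1) (ball 0 1) := fun z hz ↦ by
    rw [mem_ball_zero_iff] at hz ⊢; rwa [hρn]
  have hqball : MapsTo q (ball 0 1) (ball 0 1) := mapsTo_sqMap hw hc2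
  have hBball : MapsTo B (ball 0 1) (ball 0 1) := hqball.comp hρball
  -- derivatives of `B` on the disc
  have hρd : ∀ z, HasDerivAt (fun z : ℂ ↦ u * z) u z := fun z ↦ by
    simpa using (hasDerivAt_id z).const_mul u
  have hBd' : ∀ z, ‖z‖ < 1 → HasDerivAt B
      (deriv (discMobius (-w)) (discMobius (-c) (u * z) ^ 2) * (2 * discMobius (-c) (u * z)) *
        deriv (discMobius (-c)) (u * z) * u) z := by
    intro z hz
    have h := (hasDerivAt_sqMap hw hc2 (z := u * z) (by rw [hρn]; exact hz.le)).comp z (hρd z)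
    exact h
  have hBd : DifferentiableOn ℂ B (ball 0 1) := fun z hz ↦
    (hBd' z (mem_ball_zero_iff.1 hz)).differentiableAt.differentiableWithinAt
  have hB0 : B 0 = 0 := by
    show q (u * 0) = 0
    rw [mul_zero]
    exact sqMap_zero hc2
  -- the derivative at `0` is `u · q′(0) = 2‖c‖/(1 + ‖c‖²)`
  set β : ℝ := 2 * ‖c‖ / (1 + ‖c‖ ^ 2) with hβ
  have hB'0 : deriv B 0 = (β : ℂ) := by
    have hq0 : HasDerivAt q (deriv q 0) (u * 0) := by
      rw [mul_zero]
      exact ((differentiableOn_sqMap hw hc2).differentiableAt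
        (isOpen_ball.mem_nhds (mem_ball_self one_pos))).hasDerivAt
    have hBc : HasDerivAt B (deriv q 0 * u) 0 := hq0.comp 0 (hρd 0)
    rw [hBc.deriv, hq, deriv_sqMap_zero hw hc2]
    have h1 : ((1 - ‖w‖ ^ 2 : ℝ) : ℂ) = ((1 - ‖c‖ ^ 2 : ℝ) : ℂ) * ((1 + ‖c‖ ^ 2 : ℝ) : ℂ) := by
      rw [← hnc2]; push_cast; ring
    have h2 : (1 : ℂ) - (‖c‖ : ℂ) ^ 2 ≠ 0 := by
      exact_mod_cast (show (1 - ‖c‖ ^ 2 : ℝ) ≠ 0 by nlinarith [norm_nonneg c])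
    have h3 : (1 : ℂ) + (‖c‖ : ℂ) ^ 2 ≠ 0 := by
      exact_mod_cast (show (1 + ‖c‖ ^ 2 : ℝ) ≠ 0 by positivity)
    have hcu : c * u = (‖c‖ : ℂ) := by rw [mul_comm, huc]
    rw [h1, hβ, show 2 * c * (((1 - ‖c‖ ^ 2 : ℝ) : ℂ)) / ((((1 - ‖c‖ ^ 2 : ℝ) : ℂ)) *
      ((1 + ‖c‖ ^ 2 : ℝ) : ℂ)) * u = 2 * (c * u) * (((1 - ‖c‖ ^ 2 : ℝ) : ℂ)) /
      ((((1 - ‖c‖ ^ 2 : ℝ) : ℂ)) * ((1 + ‖c‖ ^ 2 : ℝ) : ℂ)) by ring, hcu]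
    push_cast
    field_simp
  have hβpos : 0 < β := by rw [hβ]; positivity
  have hβlt : β < 1 := by
    rw [hβ, div_lt_one (by positivity)]
    nlinarith [sq_nonneg (1 - ‖c‖), hc1]
  have hβbound : (1 - ‖w‖) ^ 2 / 8 ≤ 1 - β := by
    rw [← hnc2, hβ]
    have hpos : (0 : ℝ) < 1 + ‖c‖ ^ 2 := by positivity
    have h1 : 1 - 2 * ‖c‖ / (1 + ‖c‖ ^ 2) = (1 - ‖c‖) ^ 2 / (1 + ‖c‖ ^ 2) := by
      field_simp
      ring
    rw [h1, div_le_div_iff₀ (by norm_num : (0 : ℝ) < 8) hpos]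
    have h2 : (1 + ‖c‖) ^ 2 * (1 + ‖c‖ ^ 2) ≤ 8 := by nlinarith [hcn, hc1]
    calc (1 - ‖c‖ ^ 2) ^ 2 * (1 + ‖c‖ ^ 2) = (1 - ‖c‖) ^ 2 * ((1 + ‖c‖) ^ 2 * (1 + ‖c‖ ^ 2)) := by
          ring
      _ ≤ (1 - ‖c‖) ^ 2 * 8 := by gcongr
  -- the new domain `V' = 𝔻 ∩ B⁻¹(V)`
  set V' : Set ℂ := ball 0 1 ∩ B ⁻¹' V with hV'
  have hV'o : IsOpen V' := hBd.continuousOn.isOpen_inter_preimage isOpen_ball hVo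
  have h0V' : (0 : ℂ) ∈ V' := ⟨mem_ball_self one_pos, by rw [mem_preimage, hB0]; exact h0⟩
  -- `B' ≠ 0` on `V'`: the only critical point of `q` is `-c`, with critical value `w ∉ V`
  have hB' : ∀ z ∈ V', deriv B z ≠ 0 := by
    intro z hz
    have hz1 : ‖z‖ < 1 := mem_ball_zero_iff.1 hz.1
    rw [(hBd' z hz1).deriv]
    have huz1 : ‖u * z‖ ≤ 1 := by rw [hρn]; exact hz1.le
    have hmz : ‖discMobius (-c) (u * z)‖ < 1 :=
      mem_ball_zero_iff.1 (mapsTo_discMobius hnegc (mem_ball_zero_iff.2 (by rw [hρn]; exact hz1)))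
    have hm2 : ‖discMobius (-c) (u * z) ^ 2‖ ≤ 1 := by
      rw [norm_pow]; nlinarith [norm_nonneg (discMobius (-c) (u * z))]
    refine mul_ne_zero (mul_ne_zero (mul_ne_zero (deriv_discMobius_ne_zero hnegw hm2)
      (mul_ne_zero two_ne_zero ?_)) (deriv_discMobius_ne_zero hnegc huz1)) hu0
    rw [Ne, discMobius_eq_zero_iff hnegc huz1]
    intro huz
    apply hwV
    have : B z = w := by
      show discMobius (-w) (discMobius (-c) (u * z) ^ 2) = w
      exact (sqMap_eq_iff hw hc2 huz1).2 huz
    rw [← this]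
    exact hz.2
  refine ⟨B, V', β, hBd, hBball, hB0, hB'0, hβpos, hβlt, hβbound, hV'o, inter_subset_left, h0V',
    fun z hz ↦ ⟨fun h ↦ h.2, fun h ↦ ⟨hz, h⟩⟩, fun z hz ↦ hz.2, hB', ?_⟩
  -- the based lifting property: a holomorphic square root of `φ_w ∘ g`, sign fixed by `y`
  intro g hgd hgV y hy hyg
  have hg1 : ∀ z ∈ ball (0 : ℂ) 1, ‖g z‖ < 1 := fun z hz ↦ mem_ball_zero_iff.1 (hV (hgV hz))
  set ψ : ℂ → ℂ := fun z ↦ discMobius w (g z) with hψ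
  have hψd : DifferentiableOn ℂ ψ (ball 0 1) :=
    (differentiableOn_discMobius hw).comp hgd (fun z hz ↦ hV (hgV hz))
  have hψ0 : ∀ z ∈ ball (0 : ℂ) 1, ψ z ≠ 0 := by
    intro z hz h
    rw [hψ, discMobius_eq_zero_iff hw (hg1 z hz).le] at h
    exact hwV (h ▸ hgV hz)
  obtain ⟨η, hηd, hη⟩ := hasSqrt_ball.exists_forall_sq_eq hψd hψ0
  have hη1 : ∀ z ∈ ball (0 : ℂ) 1, ‖η z‖ < 1 := by
    intro z hz
    have h1 : ‖η z‖ ^ 2 < 1 := by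
      rw [← norm_pow, hη z]
      exact norm_discMobius_lt_one hw (hg1 z hz)
    nlinarith [norm_nonneg (η z)]
  -- `η 0 = ± φ_{-c} (u y)`
  have hy1 : ‖y‖ < 1 := mem_ball_zero_iff.1 hy.1
  have huy : ‖u * y‖ ≤ 1 := by rw [hρn]; exact hy1.le
  have hmy : ‖discMobius (-c) (u * y)‖ < 1 :=
    mem_ball_zero_iff.1 (mapsTo_discMobius hnegc (mem_ball_zero_iff.2 (by rw [hρn]; exact hy1)))
  have hη0sq : η 0 ^ 2 = discMobius (-c) (u * y) ^ 2 := by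
    rw [hη 0, hψ]
    simp only
    rw [← hyg]
    show discMobius w (discMobius (-w) (discMobius (-c) (u * y) ^ 2)) = _
    exact discMobius_discMobius_neg hw
      (by rw [norm_pow]; nlinarith [norm_nonneg (discMobius (-c) (u * y))])
  obtain ⟨η', hη'd, hη', hη'0, hη'1⟩ : ∃ η' : ℂ → ℂ, DifferentiableOn ℂ η' (ball 0 1) ∧
      (∀ z, η' z ^ 2 = ψ z) ∧ η' 0 = discMobius (-c) (u * y) ∧ ∀ z ∈ ball (0 : ℂ) 1, ‖η' z‖ < 1 := by
    rcases sq_eq_sq_iff_eq_or_eq_neg.1 hη0sq with h | h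
    · exact ⟨η, hηd, hη, h, hη1⟩
    · refine ⟨fun z ↦ -η z, hηd.neg, fun z ↦ by rw [neg_sq, hη z], ?_,
        fun z hz ↦ by rw [norm_neg]; exact hη1 z hz⟩
      show -η 0 = _
      rw [h, neg_neg]
  -- the lift `ĝ = conj u · φ_c ∘ η'`
  set gl : ℂ → ℂ := fun z ↦ conj u * discMobius c (η' z) with hgl
  have hgl_eq : ∀ z ∈ ball (0 : ℂ) 1, discMobius (-c) (u * gl z) = η' z := by
    intro z hz
    show discMobius (-c) (u * (conj u * discMobius c (η' z))) = η' z
    rw [← mul_assoc, mul_comm u, hconju, one_mul]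
    exact discMobius_neg_discMobius hc1 (hη'1 z hz).le
  have hglball : MapsTo gl (ball 0 1) (ball 0 1) := by
    intro z hz
    rw [mem_ball_zero_iff, hgl]
    simp only [norm_mul, norm_conj, hun, one_mul]
    exact norm_discMobius_lt_one hc1 (hη'1 z hz)
  have hBgl : ∀ z ∈ ball (0 : ℂ) 1, B (gl z) = g z := by
    intro z hz
    show discMobius (-w) (discMobius (-c) (u * gl z) ^ 2) = g z
    rw [hgl_eq z hz, hη' z, hψ]
    exact discMobius_neg_discMobius hw (hg1 z hz).le
  refine ⟨gl, ?_, fun z hz ↦ ⟨hglball hz, ?_⟩, ?_, hBgl⟩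
  · exact ((differentiableOn_discMobius hc1).comp hη'd
      (fun z hz ↦ mem_ball_zero_iff.2 (hη'1 z hz))).const_mul _
  · rw [mem_preimage, hBgl z hz]
    exact hgV hz
  · show conj u * discMobius c (η' 0) = y
    rw [hη'0, discMobius_discMobius_neg hc1 huy, ← mul_assoc, hconju, one_mul]

end Koebe

end Literature.Analysis.Complex

end
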